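import Summits.ResolutionOfSingularities.ResolutionOfSingularities.Theorems.MarkedTransferCampaignG1PnegaInterfaceV2
import HarnessLib

/-!
# [OURS · L1 G1] The `℘nega` INTERFACE, v0.5 — THE CHECKLIST OF RECORD `Campaign.PnegaInterfaceV3` (res-D-plan-1's V3 RULING
# 2026-08-27T01:55:32Z adopting res-adj-1's ℘nega-INTERFACE CHECK corrections C1–C4 of 01:41:03Z and adding C5–C8, + the F6d/F7b
# ruling for module-valued candidates 02:09:04Z; statements byte-for-byte `D/res-D-plan-1/PnegaInterface.v04.draft.lean` rev 0.5
# sha16 eb7ec19c2f73e483; carried summit-side by the typer of record res-L1-type-o2 as a NEW sibling file — V2 rev 2.2 is superseded)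

Why a third file: the gate's append-only rule for `Theorems/` («deprecate, don't mutate») forbids changing the V2 decls of
`MarkedTransferCampaignG1PnegaInterfaceV2.lean` (p482012 / p482410, tree sha16 f0f0f0f6295ff190) in place; so V2 stays as the
record of what was checked (director-resolution 2026-08-27T01:55:25Z: lemmas quantifying over INHABITANTS of `PnegaInterfaceV2` —
`PnegaInterface.toV2`, res-type-087's K2 squeeze, the v0.3 decisive cell — are VACUOUS-AS-TYPED, not wrong; per-field cells on a
candidate's OWN `tilde` stay meaningful) and the corrected checklist lives here under NEW names. Everything in the v0/V2 headers
(LADDER context, director-resolution RULINGS 2026-08-27T00:20:08Z (c) / 00:40:38Z / 00:58:10Z (1) / 01:55:25Z, roles: res-D-plan-1 =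
field-list authority, res-adj-1 + res-plan-2 = scorers, o2 = Lean typer; host `--supports stmt-ResolutionOfSingularities-15522`;
FIELD ↔ TABLE MAP) applies verbatim and is not repeated, EXCEPT the two page locators of the table rows F3/F9 which were WRONG in v0
and V2 (res-ref-a6 OURS-DESK #54 lane A 01:38:38Z, res-ref-a7 #65 lane A 01:46:36Z, res-D-plan-1 ERRATA 01:40:14Z) and read
correctly here: Rem 11.4 = p.63 L31–L33 (not p.62); Th 9.18 = p.55 L34–L37, proof p.56 L1–L2 (not p.58). Reused from the v0/V2
files (imported, not restated): `Campaign.PnegaProvenance` (provenance slots), `S11CoordFree.BlSub` carriers and the V2 §3 `Tails`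
slot predicates (`PnegaInterfaceV2.TailsNonDegenerate…`, which do not mention the structure and stay as they are).
SCORING GRAMMAR of record (res-D-plan-1 v0.5, res-adj-1 02:12:30Z): F6c `OStable` · F6d-gen `NormDemandGen` · F6d-elt `NormDemand` ·
F7c `NonVanishing` · F7b-unit `neg_proper` · F1 `transform_mem/_le` · F2 `pos_eq`+`mul_mem` · F3⁻ `diff_mem_neg` · F3.1–F3.4
(separate obligation defs, typed later, append-only) · F4 `baseChange_mem/_le` · F8⁻ `antitone_nonpos` · F9 `root_closed` · O1–O6.

WHY V3 (res-adj-1 ℘nega-INTERFACE CHECK 2026-08-27T01:41:03Z, kernel `ledger/group-1/INTERFACE-CHECK-v02-kernel.lean`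
ffc08c73dddd7ea4: `IsEmpty (PnegaInterfaceV2 K p prov)` for every non-trivial `K` by E-A (unguarded `mul_mem` vs `pos_eq`),
E-C (unguarded `root_closed`), E-B (blanket F3 `diff_mem` from NON-NEGATIVE sources + F2 ⇒ `tilde P (−a) = ⊤` = the R01
collapse engine typed INTO the interface ⇒ ⊥ with F7b)); plus two further emptiness mechanisms found by res-D-plan-1 while
ruling (01:5xZ): E-D — F5 `mem_iff46` is lethal BY ITSELF: its right-hand side `g^{p^ℓ}·f ∈ P (q·p^ℓ − a)` holds for EVERY `f`
once `P` is antitone and multiplicative (`g^{p^ℓ} ∈ P (q p^ℓ) ⊆ P (q p^ℓ − a)`), so `↔` forces every `f ≠ 0` into `tilde P (−a)`,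
i.e. `= ⊤`, contradicting F7b — restricting to `a > 0` (res-adj-1 C2) does not help; E-E — CROSS-BOUNDARY antitone
(`tilde P 0 ⊇ P 1`, hence `tilde P (−1) ⊇ P q ∋ g`) + F3⁻ (Diff from negative sources) already collapse: the images `D (g·c)`,
`ord D ≤ q`, additively span the IDEAL `diffIdeal K q (P q) ⊇ diffIdeal K q (span {g}) = ⊤` (operators of order `≤ q` form a
`B`-module), so `1 ∈ tilde P (−1−q)` and `O`-multiples follow ⇒ `⊤`; and E-F — F9 in negative degrees over NON-REDUCED
algebras: in `B = K[x][ε]/(ε²)` every `K[x]`-linear endomorphism is a `K`-differential operator of order ≤ 2, so a Diff-stable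
proper additive subgroup in a negative degree is `⊥`, while F9 puts `ε` into it (`ε^p = 0`).

RULING (res-D-plan-1 01:55:32Z, adopting res-adj-1 C1–C4 by name and adding C5–C7; C8 = res-ref-a7 #65 (2)–(5) folded into the
F7b / F4 / F6a field docstrings below; + 02:09:04Z: F7b re-typed as F7b-unit «no unit in a negative piece», F6d-gen `NormDemandGen`
for module-valued candidates at the §13 slot, `neg_ne_top_of_neg_proper`, E-D certificate `eq46_rhs_of_isCharFiltration`):
* C1 (adj-1) ADOPTED — F3 SPLIT: the structure keeps only F3⁻ `diff_mem_neg` (SOURCE degrees `i < 0`); the consumed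
  crossing instances F3.1 (Th 7.11 (1) p.38 L26–L28), F3.2 (Th 14.1 proof p.68 L19–L20, sources in `𝔏₀(∞) ∩ ℘posi`), F3.3
  (§9.3 `⊟(g,a) ⊂ ℘̃`, the 17 S09 slot hypotheses), F3.4 (Rem 11.4 p.63 L31–L33, `Rem11_4_of_absorbs`) become SEPARATE named
  obligations `def`'d over the structure by the typer with the consumer's restricted source/operator family (scored N/A until typed).
* C2 (adj-1) ADOPTED — ONE standing guard `IsCharFiltration K P` (`P 0 = ⊤`, antitone, multiplicative, Th 4.1 Diff-shape) on
  every `P`-quantified field; F9 for target degrees `i ≤ 0` only.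
* C3 (adj-1) — F9 degree convention `b^p ∈ tilde P (p·i) → b ∈ tilde P i` CONFIRMED, kept.
* C4 (adj-1) — F7c `NonVanishing` kept (regime = F7b's (37)-datum, confirmed); decisive cell F6c × F6d × F7c; F7b separate.
* C5 (plan-1) — F5 `mem_iff46` REMOVED from the structure (E-D): as printed, Eq. (46) `⇐` is universally valid at an admissible
  `P` and `⇒` is then content-free; what Th 6.3 should demand of a replacement is a READING QUESTION for R03 (res-adj-3 G3 /
  res-adj-1) → obligation O5 «membership criterion of (46)-type, reading pending»; consumers (`eq46_of_mem_pTilde`, Th 7.11 (2)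
  p.38 L30) are served by name once a reading is ruled. Scored N/A.
* C6 (plan-1) — F8 antitone RESTRICTED to non-positive degrees (`antitone_nonpos`; positive degrees = the guard's antitone `P`);
  the cross-boundary inclusion `P j ⊆ tilde P i` (`i ≤ 0 < j`) is obligation O6, NEVER demanded (E-E: with F3⁻ it is the collapse).
* C7 (plan-1) — F9 `root_closed` guarded by `[IsReduced B]` (E-F); the regime's rings (stalks / sections / blow-up algebras /
  completions of smooth `Z` over a field) are reduced.
REGRESSION (res-adj-1's test): E-A / E-C cannot be replayed (guard), E-B cannot (no non-negative-source Diff field), E-D / E-E /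
E-F cannot (C5 / C6 / C7); and the structure is INHABITED: `PnegaInterfaceV3.bypass` (the «⊥-bypass»: `P` in positive degrees,
`⊥` in degrees `≤ 0`, empty provenance) — `nonempty_bypass`. The bypass FAILS exactly F7c `NonVanishing` at any (37)-placement
(`bypass_not_nonVanishing_of_datum`), which is what makes F7c the discriminating cell. Unchanged from V2 (same text, same
sources): `tilde`, `pos_eq` (now guarded), `mul_mem` (guarded), `transform_mem/_le`, `baseChange_mem/_le`, `neg_le_sing`, and the
scored predicates `NormDemand` (F6d-elt), `OStable` (F6c), `NonVanishing` (F7c, v0.3, now guarded); `neg_proper` is guarded AND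
re-typed (F7b-unit). B6 SATISFIABILITY WITNESS (director-resolution 01:55:25Z (1) «V3 is ADMISSIBLE only with a toy inhabitant
constructed in the kernel, sorry-free»; SIZED-ASK v1.1 (b2′)) = `PnegaInterfaceV3.bypass` / `nonempty_bypass` in THIS file.
HONEST FRAMING. Nothing here is a statement of H. Hironaka's manuscript *Resolution of singularities in positive
characteristics* (2017-03-23, [Hironaka2017], lit key `paper:url-3343fd9e678b`): every printed item named below is a
CANDIDATE [claim: Hironaka2017, status: under-review] and enters only as the SHAPE of a property a replacement must have; no
field is asserted for any candidate for the manuscript's `℘nega`; the only inhabitant exhibited is the diagnostic «⊥-bypass»,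
which is nobody's candidate. OURS; AI typing is weaker than expert review; nothing here is progress on resolution of
singularities in positive characteristic; no claim beyond the kernel.
-/

noncomputable section

set_option linter.dupNamespace false -- mandated namespace of this single-conjunct summit

namespace Summit.ResolutionOfSingularities.ResolutionOfSingularities.Theorems.Campaign

open Literature.AlgebraicGeometry.Resolution
open Literature.AlgebraicGeometry.Hironaka2017
open Literature.AlgebraicGeometry.Hironaka2017.S11CoordFree (BlSub)

universe u v

/-- [OURS · L1 G1 ℘nega-INTERFACE v0.4 · guard C2] replaces the role of «`P j = ℘(E,j)` is the characteristic-algebra filtration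
of Th 4.1» as the STANDING HYPOTHESIS of every `P`-quantified field (res-adj-1 C2): `P 0 = ⊤` (degree-0 piece is the ring),
antitone, multiplicative, and Diff-stable in the Th 4.1 shape `Diff^{(μ)} P(a) ⊂ P(a−μ)` for `μ < a` (row 003 / Th 4.1 p.16;
the binder `hdiff` of `pTildeNeg_le_of_diffStable`). NOT a statement of the manuscript. VACUITY: satisfied by `fun _ => ⊤`
(where no (37)-datum exists) and by the `𝔪`-adic filtration of `K[x]` (res-adj-1's instance `mPow`). [folklore] -/
def IsCharFiltration (K : Type u) [CommRing K] {B : Type v} [CommRing B] [Algebra K B] (P : ℕ → Ideal B) : Prop :=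
  P 0 = ⊤ ∧ (∀ i j : ℕ, i ≤ j → P j ≤ P i) ∧ (∀ i j : ℕ, P i * P j ≤ P (i + j)) ∧
    (∀ a μ : ℕ, μ < a → diffIdeal K μ (P a) ≤ P (a - μ))

/-- [OURS · L1 G1 ℘nega-INTERFACE — THE CHECKLIST, v0.4] replaces the role of «what §§6–7 and §§13–16 consume of
`℘̃(E,·) / ℘nega(E,−a)`»: the V2 checklist (`MarkedTransferCampaignG1PnegaInterfaceV2.lean`, field docstrings and sources there)
with res-adj-1's corrections C1–C4 (2026-08-27T01:41:03Z) and res-D-plan-1's C5–C7: every `P`-quantified field GUARDED by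
`IsCharFiltration K P`; F3 restricted to NEGATIVE source degrees (`diff_mem_neg`); F5 `mem_iff46` removed (obligation O5); F8
restricted to non-positive degrees (`antitone_nonpos`; cross-boundary = obligation O6); F9 for `i ≤ 0` over reduced `B`.
NOT a statement of the manuscript. VACUITY: INHABITED — `PnegaInterfaceV3.bypass` / `nonempty_bypass` (diagnostic inhabitant,
fails F7c); the printed candidate `PnegaInterfaceV2.printedTilde` is known NOT to inhabit it (F1 ✗, F7b ✗ — R01/R04). [folklore] -/
structure PnegaInterfaceV3 (K : Type u) [CommRing K] (p : ℕ) (prov : PnegaProvenance.{u, v} K) :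
    Type (max u (v + 1)) where
  /-- the candidate: `tilde B P i` = «℘̃(E,i)», an additive subgroup of `B` in each degree (as V2) -/
  tilde : ∀ {B : Type v} [CommRing B] [Algebra K B], (ℕ → Ideal B) → ℤ → AddSubgroup B
  /-- F2 / O4 — positive part untouched (V2 `pos_eq`, guarded) -/
  pos_eq : ∀ {B : Type v} [CommRing B] [Algebra K B] (P : ℕ → Ideal B), IsCharFiltration K P →
    ∀ i : ℕ, 0 < i → tilde P (i : ℤ) = (P i).toAddSubgroup
  /-- F2 — product rule Lem 5.8 p.28 L7–L8 (V2 `mul_mem`, guarded; res-adj-1 E-A) -/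
  mul_mem : ∀ {B : Type v} [CommRing B] [Algebra K B] (P : ℕ → Ideal B), IsCharFiltration K P →
    ∀ (i j : ℤ) (a b : B), a ∈ tilde P i → b ∈ tilde P j → a * b ∈ tilde P (i + j)
  /-- F8 — antitone in NON-POSITIVE degrees (Lem 5.9 (1),(3) p.28 L18–L26 restricted, C6; positive degrees are the guard's;
  the cross-boundary inclusion `P j ⊆ tilde P i`, `i ≤ 0 < j`, is obligation O6 and is NOT demanded — with `diff_mem_neg` it
  is the collapse, E-E) -/
  antitone_nonpos : ∀ {B : Type v} [CommRing B] [Algebra K B] (P : ℕ → Ideal B), IsCharFiltration K P →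
    ∀ i j : ℤ, i ≤ j → j ≤ 0 → tilde P j ≤ tilde P i
  /-- F3⁻ — Diff-stability from NEGATIVE source degrees only (res-adj-1 C1: Def 5.1 (36) p.25 restricted; the consumed
  crossing instances F3.1–F3.4 are separate obligations): for every differential operator `D` of order `≤ μ` and `i < 0`,
  `D(tilde P i) ⊆ tilde P (i − μ)` -/
  diff_mem_neg : ∀ {B : Type v} [CommRing B] [Algebra K B] (P : ℕ → Ideal B), IsCharFiltration K P →
    ∀ (μ : ℕ) (D : B →ₗ[K] B), IsDiffOpLE K μ D → ∀ i : ℤ, i < 0 → ∀ f : B, f ∈ tilde P i → D f ∈ tilde P (i - μ)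
  /-- F9 — `p`-th-root closure in degrees `≤ 0` over REDUCED algebras (U54L42 p.54, Th 9.18 p.55 L34–L37 / proof p.56 L1–L2;
  convention `p·i ↦ i` CONFIRMED by res-adj-1 C3; guards C2 + C7) -/
  root_closed : ∀ {B : Type v} [CommRing B] [Algebra K B] [IsReduced B] (P : ℕ → Ideal B), IsCharFiltration K P →
    ∀ (b : B) (i : ℤ), i ≤ 0 → b ^ p ∈ tilde P (p * i) → b ∈ tilde P i
  /-- F7b — the negative pieces contain NO UNIT at a (37)-placement («F7b-unit», res-D-plan-1 ruling 02:09:04Z on director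
  02:04:38Z / res-adj-1 02:02:05Z: for AddSubgroup- or module-valued candidates the literal «≠ ⊤» of V2 `neg_proper` is too
  weak — `K·1 ≠ ⊤` — so the demand of record is `IsUnit u → u ∉ tilde P (−a)`; for ideal-valued candidates the two agree, and
  `neg_ne_top_of_neg_proper` recovers «≠ ⊤»); sources Def 5.1 p.25 l.42–44, Rem 5.4 p.26, (110) p.69 L29–L31, Th 15.9 p.79
  L16–L17, U86L16 p.86; the stronger «⊆ 𝔪_ξ / ⊆ I(Sing)» placement is F6a `neg_le_sing`. -/
  neg_proper : ∀ {B : Type v} [CommRing B] [Algebra K B] (P : ℕ → Ideal B), IsCharFiltration K P →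
    ∀ (q : ℕ) (g : B), 0 < q → g ∈ P q → (∀ k : ℕ, 0 < k → diffIdeal K (k * q) (Ideal.span {g ^ k}) = ⊤) → P q ≠ ⊤ →
      ∀ a : ℕ, 0 < a → ∀ u : B, IsUnit u → u ∉ tilde P (-(a : ℤ))
  /-- F1 — transform law (59) in one chart, first inclusion (V2 `transform_mem`, unchanged) -/
  transform_mem : ∀ {B B' : Type v} [CommRing B] [CommRing B'] [Algebra K B] [Algebra K B']
    (φ : B →ₐ[K] B') (x : B') (P : ℕ → Ideal B) (P' : ℕ → Ideal B'), prov.IsChart φ x P P' →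
      ∀ (a : ℕ) (f : B), f ∈ tilde P (-(a : ℤ)) → x ^ a * φ f ∈ tilde P' (-(a : ℤ))
  /-- F1, second inclusion (V2 `transform_le`, unchanged) -/
  transform_le : ∀ {B B' : Type v} [CommRing B] [CommRing B'] [Algebra K B] [Algebra K B']
    (φ : B →ₐ[K] B') (x : B') (P : ℕ → Ideal B) (P' : ℕ → Ideal B'), prov.IsChart φ x P P' →
      ∀ a : ℕ, (tilde P' (-(a : ℤ)) : Set B') ⊆
        (Ideal.span ((fun f : B => x ^ a * φ f) '' (tilde P (-(a : ℤ)) : Set B)) : Set B')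
  /-- F4 — compatibility with COMPLETION-type base change `φ : B → B'` (first inclusion `φ(℘̃(i)) ⊂ ℘̃'(i)`): the role
  consumed inside the proofs of Th 6.3 (p.31 l.48–50 «K[[s]] is faithfully flat over O_ξ», Th 6.6 row 039) and of Th 7.10 /
  Th 7.11 (p.38 l.20–23). RE-SOURCED after res-ref-a7 OURS-DESK #65 (4) 2026-08-27T01:46:36Z: Eq. (49) p.32 L6–L7 (tree
  `S06BaseHike.Eq49`) is NOT this demand — it is the single-ring kernel criterion `℘nega(Ê,−a) ⊂ Ker σ` for the MAXIMUM
  BASE-HIKE `Ê` (§6.1 p.29 l.17–19), tracked outside the interface by Q-06-004 (Th 6.5 R2 kernel); V2's «Eq. (49)-shape»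
  wording is withdrawn. Field text = V2 `baseChange_mem`, unchanged. -/
  baseChange_mem : ∀ {B B' : Type v} [CommRing B] [CommRing B'] [Algebra K B] [Algebra K B']
    (φ : B →ₐ[K] B') (P : ℕ → Ideal B) (P' : ℕ → Ideal B'), prov.IsCompletion φ P P' →
      ∀ (i : ℤ) (f : B), f ∈ tilde P i → φ f ∈ tilde P' i
  /-- F4, second inclusion `℘̃'(i) ⊂ φ(℘̃(i))B'` (V2 `baseChange_le`, text unchanged; sources as `baseChange_mem`). -/
  baseChange_le : ∀ {B B' : Type v} [CommRing B] [CommRing B'] [Algebra K B] [Algebra K B']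
    (φ : B →ₐ[K] B') (P : ℕ → Ideal B) (P' : ℕ → Ideal B'), prov.IsCompletion φ P P' →
      ∀ i : ℤ, (tilde P' i : Set B') ⊆ (Ideal.span (φ '' (tilde P i : Set B)) : Set B')
  /-- F6a — `℘nega(E,−a) ⊂ I(Sing E)` for `a > 0`: the demand is row 015's R08(α) binder `hN : pnega ≤ span{C a·T d : a ∈ I}`
  of `Def13p2Carrier.lean :: TFlat_subset_ideal` / `Cot_subset_radical` / `Cot_ne_top_of_subset` (p475363), read with Def 13.2
  (105)–(106) p.67 L16–L22; re-worded after res-ref-a7 #65 (5): p.67 L15 itself places `𝔏₀(∞)`, not `℘nega`, inside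
  `I(Sing)Bl(Z)`. Field text = V2 `neg_le_sing`, unchanged. -/
  neg_le_sing : ∀ {B : Type v} [CommRing B] [Algebra K B] (P : ℕ → Ideal B) (I : Ideal B),
    prov.IsSingIdeal P I → ∀ a : ℕ, 0 < a → tilde P (-(a : ℤ)) ≤ I.toAddSubgroup

namespace PnegaInterfaceV3

variable {K : Type u} [CommRing K] {p : ℕ} {prov : PnegaProvenance.{u, v} K}

/-- F6d (V2 text verbatim over V3). [folklore] -/
def NormDemand (I : PnegaInterfaceV3 K p prov) (e : ℕ) : Prop :=
  ∀ {B : Type v} [CommRing B] [Algebra K B] (P : ℕ → Ideal B) (a : ℕ), 0 < a →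
    (I.tilde P (-(a : ℤ)) : Set B) ⊆ Set.range fun b : B => b ^ p ^ e

/-- F6c (V2 text verbatim over V3; locator nit res-ref-a7 #65 (3): Def 5.1 «O_Z-submodule» is p.25 L34). [folklore] -/
def OStable (I : PnegaInterfaceV3 K p prov) : Prop :=
  ∀ {B : Type v} [CommRing B] [Algebra K B] (P : ℕ → Ideal B) (i : ℤ) (r x : B),
    x ∈ I.tilde P i → r * x ∈ I.tilde P i

/-- F7c (v0.3 text over V3, with the C2 guard). [folklore] -/
def NonVanishing (I : PnegaInterfaceV3 K p prov) : Prop :=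
  ∀ {B : Type v} [CommRing B] [Algebra K B] (P : ℕ → Ideal B), IsCharFiltration K P →
    ∀ (q : ℕ) (g : B), 0 < q → g ∈ P q → (∀ k : ℕ, 0 < k → diffIdeal K (k * q) (Ideal.span {g ^ k}) = ⊤) → P q ≠ ⊤ →
      ∃ a : ℕ, 0 < a ∧ I.tilde P (-(a : ℤ)) ≠ ⊥

/-- In positive degrees the guard gives antitonicity for free (so F8 needs no positive clause). [folklore] -/
theorem antitone_pos (I : PnegaInterfaceV3 K p prov) {B : Type v} [CommRing B] [Algebra K B] (P : ℕ → Ideal B)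
    (hP : IsCharFiltration K P) (i j : ℕ) (hi : 0 < i) (hij : i ≤ j) : I.tilde P (j : ℤ) ≤ I.tilde P (i : ℤ) := by
  rw [I.pos_eq P hP i hi, I.pos_eq P hP j (lt_of_lt_of_le hi hij)]
  intro f hf
  exact hP.2.1 i j hij hf

/-- F7b-unit implies the V2 wording «≠ ⊤». [folklore] -/
theorem neg_ne_top_of_neg_proper (I : PnegaInterfaceV3 K p prov) {B : Type v} [CommRing B] [Algebra K B]
    (P : ℕ → Ideal B) (hP : IsCharFiltration K P) (q : ℕ) (g : B) (hq : 0 < q) (hg : g ∈ P q)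
    (h37 : ∀ k : ℕ, 0 < k → diffIdeal K (k * q) (Ideal.span {g ^ k}) = ⊤) (hPq : P q ≠ ⊤) (a : ℕ) (ha : 0 < a) :
    I.tilde P (-(a : ℤ)) ≠ ⊤ := by
  intro htop
  exact I.neg_proper P hP q g hq hg h37 hPq a ha 1 isUnit_one (htop ▸ AddSubgroup.mem_top 1)

/-! ## The diagnostic inhabitant («⊥-bypass»): regression test that the checklist is not empty -/

/-- Empty provenance: no chart, no completion, no singular ideal is ever certified. [folklore] -/
def emptyProvenance (K : Type u) [CommRing K] : PnegaProvenance.{u, v} K where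
  IsChart := fun _ _ _ _ => False
  IsCompletion := fun _ _ _ => False
  IsSingIdeal := fun _ _ => False

/-- The bypass value: `P` in positive degrees, `⊥` in degrees `≤ 0`. [folklore] -/
def bypassTilde {B : Type v} [CommRing B] (P : ℕ → Ideal B) (i : ℤ) : AddSubgroup B :=
  if 0 < i then (P i.toNat).toAddSubgroup else ⊥

/-- Unfolding: in a positive degree the bypass value is the positive piece `P i`. [folklore] -/
theorem bypassTilde_of_pos {B : Type v} [CommRing B] (P : ℕ → Ideal B) {i : ℤ} (hi : 0 < i) :
    bypassTilde P i = (P i.toNat).toAddSubgroup := by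
  simp [bypassTilde, hi]

/-- Unfolding: in a degree `≤ 0` the bypass value is `⊥`. [folklore] -/
theorem bypassTilde_of_nonpos {B : Type v} [CommRing B] (P : ℕ → Ideal B) {i : ℤ} (hi : i ≤ 0) :
    bypassTilde P i = ⊥ := by
  simp [bypassTilde, not_lt.2 hi]

/-- [diagnostic · B6 satisfiability witness] The «⊥-bypass» inhabits the v0.5 checklist at the empty provenance: E-A … E-F cannot be replayed. It is NOT a
candidate for the manuscript's `℘nega` — it fails F7c `NonVanishing` (`bypass_not_nonVanishing_of_datum`). [folklore] -/
def bypass (K : Type u) [CommRing K] (p : ℕ) : PnegaInterfaceV3 K p (emptyProvenance.{u, v} K) where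
  tilde := fun P i => bypassTilde P i
  pos_eq := by
    intro B _ _ P _ i hi
    have hi' : (0 : ℤ) < (i : ℤ) := by exact_mod_cast hi
    simp [bypassTilde_of_pos P hi']
  mul_mem := by
    intro B _ _ P hP i j a b ha hb
    by_cases hi : 0 < i
    · by_cases hj : 0 < j
      · rw [bypassTilde_of_pos P hi] at ha
        rw [bypassTilde_of_pos P hj] at hb
        have hij : 0 < i + j := by omega
        rw [bypassTilde_of_pos P hij]
        have hnat : (i + j).toNat = i.toNat + j.toNat := by omega
        change a * b ∈ P (i + j).toNat
        rw [hnat]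
        exact hP.2.2.1 _ _ (Ideal.mul_mem_mul ha hb)
      · rw [bypassTilde_of_nonpos P (not_lt.1 hj)] at hb
        have hb0 : b = 0 := by simpa using hb
        simp [hb0]
    · rw [bypassTilde_of_nonpos P (not_lt.1 hi)] at ha
      have ha0 : a = 0 := by simpa using ha
      simp [ha0]
  antitone_nonpos := by
    intro B _ _ P _ i j _ hj
    simp [bypassTilde_of_nonpos P hj]
  diff_mem_neg := by
    intro B _ _ P _ μ D _ i hi f hf
    rw [bypassTilde_of_nonpos P (le_of_lt hi)] at hf
    have hf0 : f = 0 := by simpa using hf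
    simp [hf0]
  root_closed := by
    intro B _ _ _ P _ b i hi hb
    have hpi : (p : ℤ) * i ≤ 0 := by
      have : (0 : ℤ) ≤ p := by exact_mod_cast Nat.zero_le p
      nlinarith
    rw [bypassTilde_of_nonpos P hpi] at hb
    have hb0 : b ^ p = 0 := by simpa using hb
    have hb' : b = 0 := IsReduced.eq_zero b ⟨p, hb0⟩
    simp [bypassTilde_of_nonpos P hi, hb']
  neg_proper := by
    intro B _ _ P _ q g _ _ _ hPq a ha u hu hmem
    have ha' : (-(a : ℤ)) ≤ 0 := by omega
    rw [bypassTilde_of_nonpos P ha'] at hmem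
    have hu0 : u = 0 := by simpa using hmem
    rw [hu0, isUnit_zero_iff] at hu
    exact hPq ((Ideal.eq_top_iff_one _).2 (by rw [← hu]; exact (P q).zero_mem))
  transform_mem := fun _ _ _ _ h => h.elim
  transform_le := fun _ _ _ _ h => h.elim
  baseChange_mem := fun _ _ _ h => h.elim
  baseChange_le := fun _ _ _ h => h.elim
  neg_le_sing := fun _ _ h => h.elim

/-- [B6 satisfiability witness, res-adj-1's regression test] The v0.5 checklist is INHABITED (at the empty provenance, for every
`K`, `p`): an empty checklist scores nothing (director-resolution 2026-08-27T01:55:25Z (1)). [folklore] -/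
theorem nonempty_bypass (K : Type u) [CommRing K] (p : ℕ) :
    Nonempty (PnegaInterfaceV3 K p (emptyProvenance.{u, v} K)) :=
  ⟨bypass K p⟩

/-- The bypass is `O`-stable (F6c ✓, trivially: its negative pieces are `⊥`, its positive pieces are ideals) … [folklore] -/
theorem bypass_oStable (K : Type u) [CommRing K] (p : ℕ) : (bypass.{u, v} K p).OStable := by
  intro B _ _ P i r x hx
  by_cases hi : 0 < i
  · change x ∈ bypassTilde P i at hx
    change r * x ∈ bypassTilde P i
    rw [bypassTilde_of_pos P hi] at hx ⊢
    exact (P i.toNat).mul_mem_left r hx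
  · change x ∈ bypassTilde P i at hx
    change r * x ∈ bypassTilde P i
    rw [bypassTilde_of_nonpos P (not_lt.1 hi)] at hx ⊢
    have hx0 : x = 0 := by simpa using hx
    simp [hx0]

/-- … and meets the element-wise norm demand F6d-elt for `0 < p` (trivially: `0 = 0^(p^e)`) … [folklore] -/
theorem bypass_normDemand (K : Type u) [CommRing K] {p : ℕ} (hp : 0 < p) (e : ℕ) :
    (bypass.{u, v} K p).NormDemand e := by
  intro B _ _ P a ha f hf
  have ha' : (-(a : ℤ)) ≤ 0 := by omega
  change f ∈ (bypassTilde P (-(a : ℤ)) : Set B) at hf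
  rw [bypassTilde_of_nonpos P ha'] at hf
  have hf0 : f = 0 := by simpa using hf
  exact ⟨0, by simp [hf0, zero_pow (pow_ne_zero e (Nat.pos_iff_ne_zero.1 hp))]⟩

/-- … and therefore FAILS F7c at any (37)-placement: all its negative pieces vanish. This is what makes F7c the discriminating
cell of the scoring protocol (decisive cell F6c × F6d × F7c). [folklore] -/
theorem bypass_not_nonVanishing_of_datum (K : Type u) [CommRing K] (p : ℕ)
    {B : Type v} [CommRing B] [Algebra K B] (P : ℕ → Ideal B) (hP : IsCharFiltration K P) (q : ℕ) (g : B)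
    (hq : 0 < q) (hg : g ∈ P q) (h37 : ∀ k : ℕ, 0 < k → diffIdeal K (k * q) (Ideal.span {g ^ k}) = ⊤) (hPq : P q ≠ ⊤) :
    ¬ (bypass.{u, v} K p).NonVanishing := by
  intro hNV
  obtain ⟨a, ha, hne⟩ := hNV P hP q g hq hg h37 hPq
  have ha' : (-(a : ℤ)) ≤ 0 := by omega
  exact hne (bypassTilde_of_nonpos P ha')



/-! ## F6d for module-valued candidates: the GENERATOR / NORM reading (res-D-plan-1 ruling on director 02:04:38Z) -/

section Tails

variable {O : Type v} [CommRing O] {p : ℕ} [Fact p.Prime] [CharP O p]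

/-- [OURS · L1 G1 ℘nega-INTERFACE v0.4 · F6d-gen] replaces the role of Th 14.11's norm clause for NON-`O`-stable
(AddSubgroup- / `ρ^e(O)`-module-valued) candidates, read as PRINTED on the generators (p.73 L7–L10 «the generators g_i of
𝔗♯ have ∥g_i∥ ∈ ρ^e(O)»; p.72 L30 – p.73 L11): at the §13 slot (row 015 carriers, slot value `pnega : BlSub O p ℓ` as in
`PnegaInterfaceV2.TailsNonDegenerate`), the sharp tails module `𝔗♯ = (𝔏₀(∞) ⊓ ℘posi) ⊔ pnega` is GENERATED over `ρ^ℓ(O)` by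
elements whose norm `∥g∥ = forgetDeg g` (Eq. (98) p.65, row 076) is a `p^e`-th power. This is the DECISIVE F6d cell for
module-valued candidates; the element-wise `NormDemand` (V2 l.181, «every element of tilde(−a) is a p^e-th power») is the
STRONGER R2 reading, reported alongside as F6d-elt (for ideal-valued candidates in char `p` the two readings of the demand on
the candidate's own pieces coincide, since `ρ^e(O)` is a subring). A candidate containing `℘(E,dm)` in degree `−a` is
therefore NOT automatically ✗ on F6d-gen; its TFlat / Cot cells (`TailsNonDegenerate`) and 087's HeadTypeSqueeze p485032 then
decide. NOT a statement of the manuscript. VACUITY: fails when `𝔗♯` has an element of unit norm only together with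
`TFlat = ⊤`; holds trivially for `pnega = ⊥ = L0inf ⊓ pposi`. [folklore] -/
def NormDemandGen (ℓ e : ℕ) (L0inf pposi pnega : BlSub O p ℓ) : Prop :=
  S13GLUEDDiagram.TSharp L0inf pposi pnega ≤
    Submodule.span (iterateFrobenius O p ℓ).range
      {g | g ∈ S13GLUEDDiagram.TSharp L0inf pposi pnega ∧
        S12GLUED.forgetDeg (iterateFrobenius O p ℓ).range O g ∈ Set.range (iterateFrobenius O p e)}

end Tails

/-! ## E-D certificate (C5): the right-hand side of Eq. (46) is universally true at an admissible filtration -/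

/-- [certificate · C5 / E-D] At an antitone multiplicative `P`, for `g ∈ P q` and ANY `f`, `g^(p^ℓ)·f ∈ P (q·p^ℓ − a)` for every
`a` (truncated subtraction; for `a ≤ q·p^ℓ` this is the printed degree). Hence a field `f ∈ tilde P (−a) ↔ (∃ ℓ₀, ∀ ℓ ≥ ℓ₀, …(46)…)`
forces every `f` into `tilde P (−a)`, i.e. `= ⊤` — incompatible with F7b. This is why F5 is not a field of `PnegaInterfaceV3`
(obligation O5, reading pending with R03). [folklore] -/
theorem eq46_rhs_of_isCharFiltration {B : Type v} [CommRing B] [Algebra K B] (P : ℕ → Ideal B)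
    (hP : IsCharFiltration K P) (q : ℕ) (g : B) (hg : g ∈ P q) (ℓ a : ℕ) (f : B) :
    g ^ p ^ ℓ * f ∈ P (q * p ^ ℓ - a) := by
  have hpow : ∀ n : ℕ, g ^ n ∈ P (q * n) := by
    intro n
    induction n with
    | zero => simp [hP.1]
    | succ n ih =>
      rw [pow_succ, Nat.mul_succ]
      exact hP.2.2.1 _ _ (Ideal.mul_mem_mul ih hg)
  have h1 : g ^ p ^ ℓ * f ∈ P (q * p ^ ℓ) := (P (q * p ^ ℓ)).mul_mem_right f (hpow (p ^ ℓ))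
  exact hP.2.1 _ _ (Nat.sub_le _ _) h1

end PnegaInterfaceV3

end Summit.ResolutionOfSingularities.ResolutionOfSingularities.Theorems.Campaign
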